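import Literature.MathematicalPhysics.QuantumFieldTheory.BalabanImbrieJaffe1984to88.BIJ85Ineq724Torus
import Literature.MathematicalPhysics.QuantumFieldTheory.Balaban1983to89.B5Eq117TorusCarriers
import Literature.MathematicalPhysics.QuantumFieldTheory.Balaban1983to89.B5Ineq1101QGQTorus

/-!
# `BalabanImbrieJaffe1984to88.BIJ85Ineq722DeltaA` — T. Bałaban, J. Imbrie, A. Jaffe, *Renormalization of the Higgs model: minimizers,
propagators and the stability of mean field theory*, Commun. Math. Phys. **97** (1985) 299–329 [BalabanImbrieJaffe1985], Sect. 7.2 p. 325,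
**(7.2.1)–(7.2.2) ON THE TORUS FOR THE PRINTED OPERATOR `G = Δ_a⁻¹` OF [6I]** — file 4 of row C1.Eq7.2.1-7.2.2: the two [6I] Sect.-E inputs that
files 1–3 (`BIJ85Ineq722Proof`, `…Part2`, `BIJ85Ineq722Torus`) and the (7.2.4) knitting (`BIJ85Ineq724Torus`) kept as hypotheses of the printed
shape — the SYMMETRY of `G_k` ([6I] Prop. 1.1 p. 33: «The operator G is a symmetric operator on L²(T_η)») and the LOWER BOUND (1.100)–(1.101)
p. 34 («a⁻¹(φ − 1)φ⁻¹ ≤ QGQ* … bounded from below … The same property holds for QGQ*») — are DISCHARGED for `G_k := Δ_a⁻¹`,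
`Δ_a = Δ − ∂P∂* + aQ_k^*Q_k` ([6I] (1.69)–(1.71), the tree's `B5DeltaA169.DeltaA (L^k) (Mk P k) a`) transported to the `Setup` torus along the
carrier identification `T^{(0)} ≃ Tor (L^k·Mk)` of `B5Eq117TorusCarriers`; hence (7.2.2) = `KernelData.Ineq722` (and Sect. 7.2's
`Ineq722 ∧ Ineq724`) hold on the torus for `H_k = G_kQ_k^*(Q_kG_kQ_k^*)⁻¹` GIVEN ONLY [6I] Proposition 1.2 (by its three displayed members, or by
its tree name `B5.Prop12Printed`).

statement-level skeleton of published theorems with citation tags; proofs where landed; nothing here is a claim about the Yang–Mills mass gap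

PDF held: `paper:balaban1985-cmp97-bij-higgs-minimizers` (journal page = PDF page + 298; p. 325 = PDF 27) and
`paper:balaban1984-cmp95-propagators-rt-i` ([6I] = [Balaban1984PropagatorsI]; journal page = PDF page + 16; pp. 29–35 = PDF 13–19); text layers
read this session (`~/.lit/texts/…/p0027.txt`, `…/p0013.txt–p0019.txt`).

CITATION HEADER (lean-in-tree rule).  Part of the lit-balaban TYPED SKELETON (HOME `run/shared/lean/pub/lit-balaban/`), Phase-2 seat p09 gen 5;
row **C1.Eq7.2.1-7.2.2** of `HOME/SKELETON.md` (typed `…BIJ85Sect7Statements.KernelData.Ineq722` p239582; owner r15, referee ref-5; ROWS cell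
«proved p251888 + p251020 + p252478 CONDITIONAL on [6I] G symmetric + (1.100) + Prop 1.2»); uses row B5.Eq1.101's torus theorems
(`B5Eq199QGQTorus`, p37 gen 3; `B5Ineq1101QGQTorus`, this seat) and row B5.Prop1.1's torus operator (`B5DeltaA169`, `B5Prop11Plancherel`).

THE PRINTED TEXT (verbatim).  [BalabanImbrieJaffe1985] p. 325: *"The kernel H_{k,μν}(x,y) and its gradient decay exponentially. In particular
there exists δ > 0 and for 0 ≤ α < 1 a constant M = M(α) < ∞ such that for |x − x′| ≤ 1, |H_{k,μν}(x,y)| + |∇H_{k,μν}(x,y)| +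
|x − x′|^{−α}|∇H_{k,μν}(x,y) − ∇H_{k,μν}(x′,y)| ≤ Me^{−δ|x−y|}. (7.2.2) This inequality is a consequence of Proposition 1.2 and the representation
(1.103) of [6I]."*  [6I] p. 30: *"We will obtain an explicit representation of Δ_a⁻¹ = G_k, or simply G. (1.71) At first let us prove that Δ_a
is a positive operator. Of course it is a symmetric operator …"*; p. 33: *"Proposition 1.1. The operator G is a symmetric operator on L²(T_η)
and …"*; p. 34: *"and can be bounded as follows a⁻¹(φ − 1)φ⁻¹ ≤ QGQ* ≤ a⁻¹I. (1.100) … from which it follows that it is bounded from below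
and above by positive constants dependent on d only (for a = 1). The same property holds for QGQ*. The condition QA = B gives the equation
− QGQ*ω = B, −ω = (QGQ*)⁻¹B, (1.102) so finally we get the representation H_kB = GQ*(QGQ*)⁻¹B. (1.103)"*.

WHAT IS PROVED (kernel; standing range `k ≤ m + K` of `Setup`; `n = L^k`, `Mk P k = (sitesPerDir k)_μ`, `EK : Site P 0 ≃ Tor (fine (L^k) (Mk P k))`;
`Site` is written `Balaban1983to89.Site` throughout, an unrelated `Site` being in scope through the imports):
* §1 the concrete [6I] data on the `Setup` carrier: `Gk hk a` = the kernel of `Δ_a⁻¹` (real part, reindexed along `EK`; `Δ_a⁻¹` is Hermitian,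
  so its real part is its symmetric part), `DGk hk a` = its forward lattice gradient `η⁻¹(G((x+ηe_λ,μ),·) − G((x,μ),·))`, and
  `deltaAData hk a : TorusData P k` = `stdData k (Gk hk a) (DGk hk a)` (with the (1.18) averaging kernel `QsStd` of file 3).
* §2 **[6I] Prop. 1.1 «G is a symmetric operator» DISCHARGED**: `Gk_isSymm` (from `B5DeltaA169.DeltaA_isHermitian`).
* §3 the dictionary for the averaging operator: the kernel of file 3's `Q = η^d(Q^*)ᵀ` IS the kernel of the B5 torus operator
  `B5Block118.QvOp (L^k) (Mk P k)` (`Q_apply_eq_QvOp`: through p16's `B5Eq117TorusCarriers.Qk_tV`, p21's `B5TowerOneStroke.cplx_Qk` and p39's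
  (1.18) one-stroke formula inside file 3's `torusRep_std_Q_mulVec`), whence `Q_k^*w` transported = `B5DeltaA169.QvAdj` of the transported `w`
  (`QvAdj_transport`) and THE QUADRATIC FORM IDENTITY `⟨w, Q_kG_kQ_k^*w⟩_{Setup} = Re⟨w♯, (QvOp·Δ_a⁻¹·QvAdj)w♯⟩` (`form_M_eq`).
* §4 **[6I] (1.100)–(1.101) «bounded from below … The same property holds for QGQ*» DISCHARGED** as file 3's hypothesis `M_lower`:
  `γ_E·Σ_p w_p² ≤ Σ_p w_p(Q_kG_kQ_k^*w)_p` with `γ_E = γ₀/(4d + a)` INDEPENDENT OF `k` AND OF THE TORUS (`M_lower_deltaA`, from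
  `B5Ineq1101QGQTorus.re_form_QGQ_ge`); hence `TorusHyps` with NO analytic hypothesis left (`torusHyps_deltaA`).
* §5 **ROW C1.Eq7.2.1-7.2.2 FOR THE PRINTED OPERATOR**: `KernelData.Ineq722` on the torus for `H_k = G_kQ_k^*(Q_kG_kQ_k^*)⁻¹`, `G_k = Δ_a⁻¹`, GIVEN ONLY
  the three displayed members of [6I] Prop. 1.2 (`ineq722_deltaA`) or Prop. 1.2 by its tree name `B5.Prop12Printed` (`ineq722_deltaA_of_prop12Printed`);
  and Sect. 7.2's pair (7.2.2) ∧ (7.2.4) with k-independent constants (`sect72_deltaA`).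
HONEST SCOPE.  (i) [6I] Proposition 1.2 (row B5.Prop1.2, typed `B5.Prop12Printed`/`Prop12Hyps`, NOT proved in the tree for these kernels) remains
THE hypothesis of printed shape — exactly as print derives (7.2.2) «from Proposition 1.2 and the representation (1.103)».  (ii) `G_k` is
[6I]'s `Δ_a⁻¹` at `U = 1` (the pure-Maxwell setting of [6I] Sect. 1 and of [BalabanImbrieJaffe1985] Sect. 4–5, real abelian vector potentials);
any `a > 0` (print: «if we put a = 1»; `H_k` does not depend on `a`, [6I] (1.60)/(1.103)); the kernel is read through its real part
(`Δ_a⁻¹` is Hermitian; that its entries are real is not used).  (iii) `∇G_k` is the forward difference quotient of the kernel in its first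
argument (the [6I] (1.4)/(1.108) gradient).  (iv) Constants: `γ_E = γ₀/(4d + a)`, `γ₀ = (4/π²)^{d+2}` (the tree's, not optimal).  No `def … : Prop`,
no new hypothesis bundle; the four `def`s (`Gk`, `DGk`, `deltaAData`, `indBond`) are kernels/fields with bodies.  Unit `lit-balaban-p09` (literature-prover-lit-balaban-p09-g5-0), 2026-08-21.
-/

namespace Literature.MathematicalPhysics.QuantumFieldTheory.BalabanImbrieJaffe1984to88.BIJ85Ineq722DeltaA

open Literature.MathematicalPhysics.QuantumFieldTheory.Balaban1983to89
open scoped BigOperators Matrix ComplexConjugate ComplexOrder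
open LatticeFieldCalculus B5Eq118OneStroke
open BIJ85Ineq722Proof BIJ85Ineq722Proof.Rep103 BIJ85Ineq722ProofPart2 BIJ85Sect7Statements BIJ85Ineq722Torus BIJ85Ineq724Torus
open BIJ85Ineq724Proof (Dk)
open B5Prop11Plancherel (Tor fine)
open B5Block118 (QvOp)
open B5DeltaA169 (QvAdj DeltaA DeltaA_isHermitian)
open B5Eq117TorusCarriers (Mk EK eK tV tB tV_apply tB_apply Qk_tV eBondK_symm_apply eK_symm_towerE_symm)
open B5TowerOneStroke (towerE trC trC_apply' cplx_Qk)
open B5SectBStatements (cplx Qk)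
open B5Ineq1101QGQTorus (re_form_QGQ_ge gammaE_pos)
open T4GaugeActionRate (gam0 gam0_pos)

noncomputable section

variable {P : Params} {k : ℕ}

/-! ## §1  The [6I] operator `G_k = Δ_a⁻¹` and its gradient as kernels on the `Setup` torus -/

/-- **THE PRINTED `G_k = Δ_a⁻¹` ON THE `Setup` CARRIER**: the kernel of `(B5DeltaA169.DeltaA (L^k) (Mk P k) a)⁻¹` ([6I] (1.69)–(1.71):
`Δ_a = Δ − ∂P∂* + aQ_k^*Q_k`, `G_k = Δ_a⁻¹`, at `U = 1` on the fine torus `T_η = Tor (fine (L^k) (Mk P k))`), reindexed along the carrier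
identification `EK : T^{(0)} ≃ Tor (fine (L^k) (Mk P k))` and read through its real part (`Δ_a⁻¹` is Hermitian, §2).
[cite: Balaban1984PropagatorsI, (1.71) p.30] -/
def Gk (hk : k ≤ P.m + P.K) (a : ℝ) : Matrix (Balaban1983to89.Site P 0 × Fin P.d) (Balaban1983to89.Site P 0 × Fin P.d) ℝ :=
  fun i j => ((DeltaA (P.L ^ k) (Mk P k) a)⁻¹ (EK hk i.1, i.2) (EK hk j.1, j.2)).re

/-- **the gradient kernel `∇G_k`**: `(∇_λ(G_kJ)_μ)(x) = Σ DGk (x,λ,μ) (x′,μ′) J_{μ′}(x′)` with the forward difference quotient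
`η⁻¹(G_k((x + ηe_λ, μ), ·) − G_k((x, μ), ·))`, `η⁻¹ = L^k` ([6I] (1.4), (1.108)). [cite: Balaban1984PropagatorsI, (1.108) p.35] -/
def DGk (hk : k ≤ P.m + P.K) (a : ℝ) : Matrix (Balaban1983to89.Site P 0 × Fin P.d × Fin P.d) (Balaban1983to89.Site P 0 × Fin P.d) ℝ :=
  fun i j => (P.L : ℝ) ^ k * (Gk hk a (i.1.shift i.2.1, i.2.2) j - Gk hk a (i.1, i.2.2) j)

/-- **THE TORUS DATA OF SECT. 7.2 FOR THE PRINTED OPERATORS**: `G = G_k = Δ_a⁻¹`, `∇G = ∇G_k`, `Q^* = Q_k^*` of (1.18) (file 3's `QsStd`).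
[cite: BalabanImbrieJaffe1985, (7.2.1) p.325] -/
def deltaAData (hk : k ≤ P.m + P.K) (a : ℝ) : TorusData P k := stdData k (Gk hk a) (DGk hk a)

/-- unfolding: `deltaAData = stdData k (Gk hk a) (DGk hk a)`. [cite: BalabanImbrieJaffe1985, (7.2.1) p.325] -/
theorem deltaAData_eq (hk : k ≤ P.m + P.K) (a : ℝ) : deltaAData (P := P) hk a = stdData k (Gk hk a) (DGk hk a) := rfl

/-! ## §2  [6I] Prop. 1.1: «The operator G is a symmetric operator» — DISCHARGED for `G_k = Δ_a⁻¹` -/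

/-- `Δ_a⁻¹` is Hermitian (`Δ_a` is, `B5DeltaA169.DeltaA_isHermitian`). [cite: Balaban1984PropagatorsI, Prop. 1.1 p.33] -/
theorem DeltaA_inv_isHermitian (P : Params) (k : ℕ) {a : ℝ} (ha : 0 < a) :
    ((DeltaA (P.L ^ k) (Mk P k) a)⁻¹).IsHermitian :=
  (DeltaA_isHermitian (P.L ^ k) (Nat.one_le_pow _ _ P.L_pos) (Mk P k) a ha).inv

/-- **[6I] Prop. 1.1 «G is a symmetric operator on L²(T_η)» for the kernel `G_k` on the `Setup` torus**: `(Gk hk a)ᵀ = Gk hk a` — file 3's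
hypothesis `TorusHyps.G_symm` DISCHARGED. [cite: Balaban1984PropagatorsI, Prop. 1.1 p.33] -/
theorem Gk_isSymm (hk : k ≤ P.m + P.K) {a : ℝ} (ha : 0 < a) : (Gk hk a).IsSymm := by
  ext i j
  have h := (DeltaA_inv_isHermitian P k ha).apply (EK hk i.1, i.2) (EK hk j.1, j.2)
  -- `h : star (G (EK j) (EK i)) = G (EK i) (EK j)`
  show ((DeltaA (P.L ^ k) (Mk P k) a)⁻¹ (EK hk j.1, j.2) (EK hk i.1, i.2)).re
      = ((DeltaA (P.L ^ k) (Mk P k) a)⁻¹ (EK hk i.1, i.2) (EK hk j.1, j.2)).re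
  rw [← h, Complex.star_def, Complex.conj_re]

/-! ## §3  The dictionary for the averaging operator: file 3's `Q` IS `B5Block118.QvOp`, `Q^*` IS `B5DeltaA169.QvAdj` -/

/-- the indicator bond field of the fine bond `i = (x, μ)`. [cite: Balaban1984PropagatorsI, (1.18) p.20] -/
def indBond (i : Balaban1983to89.Site P 0 × Fin P.d) : VecField P 0 ℝ := fun b => if (b.src, b.dir) = i then 1 else 0

/-- the indicator bond field read on `Site × Fin d` is `Pi.single i 1`. [cite: Balaban1984PropagatorsI, (1.18) p.20] -/
theorem indBond_pair (i j : Balaban1983to89.Site P 0 × Fin P.d) : indBond i ⟨j.1, j.2⟩ = if j = i then (1 : ℝ) else 0 := rfl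

/-- the transported (complexified) indicator bond field is `Pi.single (EK x, μ) 1`. [cite: Balaban1984PropagatorsI, (1.18) p.20] -/
theorem trC_indBond (hk : k ≤ P.m + P.K) (i : Balaban1983to89.Site P 0 × Fin P.d) :
    trC (towerE P.L (Mk P k) k) (cplx (tV hk (indBond i))) = Pi.single (EK hk i.1, i.2) (1 : ℂ) := by
  funext z
  obtain ⟨z1, μ⟩ := z
  rw [trC_apply', Pi.single_apply]
  simp only [cplx, tV_apply, eBondK_symm_apply, eK_symm_towerE_symm]
  show (((if ((EK hk).symm z1, μ) = i then (1 : ℝ) else 0) : ℝ) : ℂ) = _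
  have e : (((EK hk).symm z1, μ) = i) ↔ ((z1, μ) = (EK hk i.1, i.2)) := by
    rw [Prod.ext_iff, Prod.ext_iff, Equiv.symm_apply_eq]
  by_cases hz : (z1, μ) = (EK hk i.1, i.2)
  · rw [if_pos hz, if_pos (e.mpr hz), Complex.ofReal_one]
  · rw [if_neg hz, if_neg (mt e.mp hz), Complex.ofReal_zero]

/-- **file 3's averaging kernel IS `QvOp`**: `Q(p, i) = QvOp (L^k) (Mk P k) p (EK i)` (as a complex number; both are [6I] (1.18) —
file 3's `torusRep_std_Q_mulVec` (p39's one-stroke `eq118`) and p16's `Qk_tV` ∘ p21's `cplx_Qk`). [cite: Balaban1984PropagatorsI, (1.18) p.20] -/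
theorem Q_apply_eq_QvOp (hk : k ≤ P.m + P.K) (G : Matrix (Balaban1983to89.Site P 0 × Fin P.d) (Balaban1983to89.Site P 0 × Fin P.d) ℝ)
    (DG : Matrix (Balaban1983to89.Site P 0 × Fin P.d × Fin P.d) (Balaban1983to89.Site P 0 × Fin P.d) ℝ)
    (p : Balaban1983to89.Site P k × Fin P.d) (i : Balaban1983to89.Site P 0 × Fin P.d) :
    (((torusRep P k (stdData k G DG)).Q p i : ℝ) : ℂ) = QvOp (P.L ^ k) (Mk P k) (p.1, p.2) (EK hk i.1, i.2) := by
  -- file 3: `(Q 1_i)_p = (Q_k 1_i)_p`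
  have h2 : (torusRep P k (stdData k G DG)).Q p i = bondAvgIter k (indBond i) ⟨p.1, p.2⟩ := by
    rw [← torusRep_std_Q_mulVec (G := G) (DG := DG) hk (indBond i) p]
    show (torusRep P k (stdData k G DG)).Q p i
      = ∑ j : Balaban1983to89.Site P 0 × Fin P.d, (torusRep P k (stdData k G DG)).Q p j * indBond i ⟨j.1, j.2⟩
    simp only [indBond_pair, mul_ite, mul_one, mul_zero, Finset.sum_ite_eq', Finset.mem_univ, if_true]
  -- the tower: `(Q_k 1_i)_p = (QvOp (1_{EK i}))_p`
  have h3 : ((bondAvgIter k (indBond i) ⟨p.1, p.2⟩ : ℝ) : ℂ)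
      = (QvOp (P.L ^ k) (Mk P k) *ᵥ trC (towerE P.L (Mk P k) k) (cplx (tV hk (indBond i)))) (p.1, p.2) := by
    have e1 : bondAvgIter k (indBond i) ⟨p.1, p.2⟩ = Qk P.L (Mk P k) k (tV hk (indBond i)) (p.1, p.2) := by
      rw [Qk_tV hk]; rfl
    rw [e1, ← cplx_Qk]
    rfl
  rw [h2, h3, trC_indBond, Matrix.mulVec_single_one]
  rfl

/-- `n^d·η^d = 1` in `ℂ`, for `η = L^{−k}`, `n = L^k`. [folklore] -/
private theorem npow_mul_etapow (k : ℕ) : ((P.L : ℂ) ^ k) ^ P.d * (((P.eta k : ℝ) : ℂ)) ^ P.d = 1 := by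
  have hL : (P.L : ℂ) ≠ 0 := Nat.cast_ne_zero.mpr P.L_pos.ne'
  unfold Params.eta
  push_cast
  rw [← mul_pow, ← mul_pow, mul_inv_cancel₀ hL, one_pow, one_pow]

/-- **`Q_k^*` of file 3 IS `QvAdj`**: for every real unit-lattice field `w`, `QvAdj (L^k) (Mk P k)` of the complexified `w` at `(EK x, μ)` is the
complexified `(Q^*w)(x, μ) = (QsStd·w)(x, μ)` (`Q^* = n^d·Qᴴ`, the (1.21) adjoint). [cite: Balaban1984PropagatorsI, (1.21) p.21] -/
theorem QvAdj_transport (hk : k ≤ P.m + P.K) (w : Balaban1983to89.Site P k × Fin P.d → ℝ) (x : Balaban1983to89.Site P 0) (μ : Fin P.d) :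
    (QvAdj (P.L ^ k) (Mk P k) *ᵥ fun p : Tor (Mk P k) × Fin P.d => ((w p : ℝ) : ℂ)) (EK hk x, μ)
      = (((QsStd P k *ᵥ w) (x, μ) : ℝ) : ℂ) := by
  -- `star (QvOp p (EK x, μ)) = Q(p, (x, μ)) = η^d·QsStd((x,μ), p)`
  have hQ : ∀ p : Tor (Mk P k) × Fin P.d, star (QvOp (P.L ^ k) (Mk P k) p (EK hk x, μ))
      = ((P.eta k ^ P.d * QsStd P k (x, μ) p : ℝ) : ℂ) := by
    intro p
    have h := Q_apply_eq_QvOp hk (0 : Matrix _ _ ℝ) (0 : Matrix _ _ ℝ) p (x, μ)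
    rw [torusRep_std_Q_apply] at h
    rw [← h, Complex.star_def, Complex.conj_ofReal]
  have lhs : (QvAdj (P.L ^ k) (Mk P k) *ᵥ fun p : Tor (Mk P k) × Fin P.d => ((w p : ℝ) : ℂ)) (EK hk x, μ)
      = ∑ p : Tor (Mk P k) × Fin P.d, ((P.L : ℂ) ^ k) ^ P.d * (((P.eta k ^ P.d * QsStd P k (x, μ) p * w p : ℝ) : ℂ)) := by
    rw [QvAdj, Matrix.smul_mulVec, Pi.smul_apply, smul_eq_mul]
    simp only [Matrix.mulVec, dotProduct, Matrix.conjTranspose_apply, hQ]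
    rw [Finset.mul_sum]
    refine Finset.sum_congr rfl fun p _ => ?_
    push_cast
    ring
  have rhs : (((QsStd P k *ᵥ w) (x, μ) : ℝ) : ℂ) = ∑ p : Tor (Mk P k) × Fin P.d, (((QsStd P k (x, μ) p * w p : ℝ) : ℂ)) := by
    simp only [Matrix.mulVec, dotProduct]
    push_cast
    rfl
  rw [lhs, rhs]
  refine Finset.sum_congr rfl fun p _ => ?_
  push_cast
  rw [← mul_assoc, ← mul_assoc, npow_mul_etapow, one_mul]

/-! ## §4  The quadratic form `⟨w, Q_kG_kQ_k^*w⟩` of the `Setup` carrier IS `Re⟨w♯, (QvOp·Δ_a⁻¹·QvAdj)w♯⟩` -/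

/-- `⟨w, Qu⟩ = η^d·⟨Q^*w, u⟩` for file 1's `Q = η^d(Q^*)ᵀ` (real transpose), any carrier. [cite: Balaban1984PropagatorsI, (1.21) p.21] -/
theorem dot_Q_mulVec (R : Rep103) (w : R.κ → ℝ) (u : R.ι → ℝ) :
    w ⬝ᵥ (R.Q *ᵥ u) = R.wη * ((R.Qs *ᵥ w) ⬝ᵥ u) := by
  rw [Rep103.Q, Matrix.dotProduct_mulVec, Matrix.vecMul_smul, Matrix.vecMul_transpose, smul_dotProduct, smul_eq_mul]

/-- `⟨w, QGQ^*w⟩ = η^d·⟨Q^*w, G(Q^*w)⟩` for file 1's `M = QGQ^*`, any carrier. [cite: Balaban1984PropagatorsI, (1.99) p.34] -/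
theorem dot_M_mulVec (R : Rep103) (w : R.κ → ℝ) :
    w ⬝ᵥ (R.M *ᵥ w) = R.wη * ((R.Qs *ᵥ w) ⬝ᵥ (R.G *ᵥ (R.Qs *ᵥ w))) := by
  rw [Rep103.M, ← Matrix.mulVec_mulVec, ← Matrix.mulVec_mulVec, dot_Q_mulVec]

/-- the real quadratic form of `G_k` is the real part of the complex form of `Δ_a⁻¹` at the transported (complexified) vector.
[cite: Balaban1984PropagatorsI, (1.71) p.30] -/
theorem dot_Gk_mulVec (hk : k ≤ P.m + P.K) (a : ℝ) (v : Balaban1983to89.Site P 0 × Fin P.d → ℝ) :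
    v ⬝ᵥ (Gk hk a *ᵥ v)
      = (star (fun z : Tor (fine (P.L ^ k) (Mk P k)) × Fin P.d => ((v ((EK hk).symm z.1, z.2) : ℝ) : ℂ))
          ⬝ᵥ ((DeltaA (P.L ^ k) (Mk P k) a)⁻¹ *ᵥ
            fun z : Tor (fine (P.L ^ k) (Mk P k)) × Fin P.d => ((v ((EK hk).symm z.1, z.2) : ℝ) : ℂ))).re := by
  -- the index equivalence `(x, μ) ↦ (EK x, μ)`
  let e : Balaban1983to89.Site P 0 × Fin P.d ≃ Tor (fine (P.L ^ k) (Mk P k)) × Fin P.d := (EK hk).prodCongr (Equiv.refl _)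
  have he : ∀ j : Balaban1983to89.Site P 0 × Fin P.d, e j = (EK hk j.1, j.2) := fun j => rfl
  have hv : ∀ j : Balaban1983to89.Site P 0 × Fin P.d, ((v ((EK hk).symm (e j).1, (e j).2) : ℝ) : ℂ) = ((v j : ℝ) : ℂ) := by
    intro j
    show ((v ((EK hk).symm (EK hk j.1), j.2) : ℝ) : ℂ) = _
    rw [Equiv.symm_apply_apply]
  -- the complex side as a double sum over the `Setup` indices
  have rhs : (star (fun z : Tor (fine (P.L ^ k) (Mk P k)) × Fin P.d => ((v ((EK hk).symm z.1, z.2) : ℝ) : ℂ))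
          ⬝ᵥ ((DeltaA (P.L ^ k) (Mk P k) a)⁻¹ *ᵥ
            fun z : Tor (fine (P.L ^ k) (Mk P k)) × Fin P.d => ((v ((EK hk).symm z.1, z.2) : ℝ) : ℂ)))
      = ∑ i, ∑ j, ((v i : ℝ) : ℂ) * ((DeltaA (P.L ^ k) (Mk P k) a)⁻¹ (EK hk i.1, i.2) (EK hk j.1, j.2) * ((v j : ℝ) : ℂ)) := by
    simp only [dotProduct, Matrix.mulVec, Pi.star_apply]
    symm
    refine Fintype.sum_equiv e _ _ fun i => ?_
    rw [hv i, Complex.star_def, Complex.conj_ofReal, Finset.mul_sum]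
    refine Fintype.sum_equiv e _ _ fun j => ?_
    rw [hv j]
    rfl
  rw [rhs, Complex.re_sum, dotProduct]
  refine Finset.sum_congr rfl fun i _ => ?_
  rw [Complex.re_sum, Matrix.mulVec, dotProduct, Finset.mul_sum]
  refine Finset.sum_congr rfl fun j _ => ?_
  rw [Complex.re_ofReal_mul, Complex.re_mul_ofReal]
  rfl

/-- `η^d = (n^d)⁻¹` in `ℝ`. [folklore] -/
private theorem etapow_eq_inv (k : ℕ) : (P.eta k ^ P.d : ℝ) = ((((P.L ^ k : ℕ) : ℝ)) ^ P.d)⁻¹ := by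
  unfold Params.eta
  rw [Nat.cast_pow, ← inv_pow, inv_pow]

/-- **THE QUADRATIC FORM IDENTITY**: for the torus data of the printed operators and every real unit-lattice field `w`,
`Σ_p w_p (Q_kG_kQ_k^*w)_p = Re⟨w♯, (QvOp·Δ_a⁻¹·QvAdj) w♯⟩` with `w♯` the complexified `w` (`Site P k × Fin d` being `Tor (Mk P k) × Fin d`).
[cite: Balaban1984PropagatorsI, (1.99) p.34] -/
theorem form_M_eq (hk : k ≤ P.m + P.K) (a : ℝ) (w : Balaban1983to89.Site P k × Fin P.d → ℝ) :
    ∑ p, w p * ((torusRep P k (deltaAData hk a)).M *ᵥ w) p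
      = (star (fun p : Tor (Mk P k) × Fin P.d => ((w p : ℝ) : ℂ)) ⬝ᵥ
          ((QvOp (P.L ^ k) (Mk P k) * (DeltaA (P.L ^ k) (Mk P k) a)⁻¹ * QvAdj (P.L ^ k) (Mk P k)) *ᵥ
            fun p : Tor (Mk P k) × Fin P.d => ((w p : ℝ) : ℂ))).re := by
  -- LHS = η^d · ⟨Q^*w, G_k Q^*w⟩ (file 1's algebra)
  have h1 : ∑ p, w p * ((torusRep P k (deltaAData hk a)).M *ᵥ w) p
      = P.eta k ^ P.d * ((QsStd P k *ᵥ w) ⬝ᵥ (Gk hk a *ᵥ (QsStd P k *ᵥ w))) :=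
    dot_M_mulVec (torusRep P k (deltaAData hk a)) w
  -- RHS = n^{-d} · ⟨QvAdj w♯, Δ_a⁻¹ QvAdj w♯⟩ (since `QvOpᴴ = n^{-d}·QvAdj`)
  have hn : ((P.L : ℂ) ^ k) ^ P.d ≠ 0 := pow_ne_zero _ (pow_ne_zero _ (Nat.cast_ne_zero.mpr P.L_pos.ne'))
  have h2 : star (fun p : Tor (Mk P k) × Fin P.d => ((w p : ℝ) : ℂ)) ⬝ᵥ
        ((QvOp (P.L ^ k) (Mk P k) * (DeltaA (P.L ^ k) (Mk P k) a)⁻¹ * QvAdj (P.L ^ k) (Mk P k)) *ᵥ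
          fun p : Tor (Mk P k) × Fin P.d => ((w p : ℝ) : ℂ))
      = ((((((P.L ^ k : ℕ) : ℝ)) ^ P.d)⁻¹ : ℝ) : ℂ) *
        (star (QvAdj (P.L ^ k) (Mk P k) *ᵥ fun p : Tor (Mk P k) × Fin P.d => ((w p : ℝ) : ℂ)) ⬝ᵥ
          ((DeltaA (P.L ^ k) (Mk P k) a)⁻¹ *ᵥ (QvAdj (P.L ^ k) (Mk P k) *ᵥ fun p : Tor (Mk P k) × Fin P.d => ((w p : ℝ) : ℂ)))) := by
    rw [← Matrix.mulVec_mulVec, ← Matrix.mulVec_mulVec, B5Action121.dotProduct_mulVec_eq_star_conjTranspose_mulVec (QvOp _ _)]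
    have e : (QvOp (P.L ^ k) (Mk P k))ᴴ *ᵥ (fun p : Tor (Mk P k) × Fin P.d => ((w p : ℝ) : ℂ))
        = ((((((P.L ^ k : ℕ) : ℝ)) ^ P.d)⁻¹ : ℝ) : ℂ) •
          (QvAdj (P.L ^ k) (Mk P k) *ᵥ fun p : Tor (Mk P k) × Fin P.d => ((w p : ℝ) : ℂ)) := by
      rw [QvAdj, Matrix.smul_mulVec, smul_smul]
      push_cast
      rw [inv_mul_cancel₀ hn, one_smul]
    rw [e, star_smul, smul_dotProduct, smul_eq_mul, Complex.star_def, Complex.conj_ofReal]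
  -- `QvAdj w♯` is the transported `Q^*w`
  have h3 : (QvAdj (P.L ^ k) (Mk P k) *ᵥ fun p : Tor (Mk P k) × Fin P.d => ((w p : ℝ) : ℂ))
      = fun z : Tor (fine (P.L ^ k) (Mk P k)) × Fin P.d => (((QsStd P k *ᵥ w) ((EK hk).symm z.1, z.2) : ℝ) : ℂ) := by
    funext z
    obtain ⟨z1, μ⟩ := z
    obtain ⟨x, rfl⟩ : ∃ x, EK hk x = z1 := ⟨(EK hk).symm z1, Equiv.apply_symm_apply _ _⟩
    rw [QvAdj_transport hk w x μ]
    show _ = (((QsStd P k *ᵥ w) ((EK hk).symm (EK hk x), μ) : ℝ) : ℂ)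
    rw [Equiv.symm_apply_apply]
  rw [h1, h2, h3, Complex.re_ofReal_mul, ← dot_Gk_mulVec hk a (QsStd P k *ᵥ w), etapow_eq_inv]

/-! ## §5  (1.100)–(1.101) DISCHARGED as `M_lower`; `TorusHyps` with NO analytic hypothesis; (7.2.2) for the printed operator -/

/-- `Re⟨w♯, w♯⟩ = Σ_p w_p²` for the complexified real field. [folklore] -/
private theorem re_dot_self (w : Balaban1983to89.Site P k × Fin P.d → ℝ) :
    (star (fun p : Tor (Mk P k) × Fin P.d => ((w p : ℝ) : ℂ)) ⬝ᵥ fun p : Tor (Mk P k) × Fin P.d => ((w p : ℝ) : ℂ)).re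
      = ∑ p, w p ^ 2 := by
  rw [dotProduct, Complex.re_sum]
  refine Finset.sum_congr rfl fun p _ => ?_
  rw [Pi.star_apply, Complex.star_def, Complex.conj_ofReal, ← Complex.ofReal_mul, Complex.ofReal_re, sq]

/-- **[6I] (1.100)–(1.101) «a⁻¹(φ − 1)φ⁻¹ ≤ QGQ* … bounded from below … The same property holds for QGQ*» AS FILE 3's HYPOTHESIS `M_lower`,
DISCHARGED for the printed operators**: `γ_E·Σ_p w_p² ≤ Σ_p w_p(Q_kG_kQ_k^*w)_p` for every real unit-lattice field `w`, `G_k = Δ_a⁻¹`, with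
`γ_E = γ₀/(4d + a)` INDEPENDENT OF `k` AND OF THE TORUS (`B5Ineq1101QGQTorus.re_form_QGQ_ge` through `form_M_eq`).
[cite: Balaban1984PropagatorsI, (1.100) p.34] -/
theorem M_lower_deltaA (hk : k ≤ P.m + P.K) {a : ℝ} (ha : 0 < a) (w : Balaban1983to89.Site P k × Fin P.d → ℝ) :
    gam0 P.d / (4 * P.d + a) * ∑ p, w p ^ 2 ≤ ∑ p, w p * ((torusRep P k (deltaAData hk a)).M *ᵥ w) p := by
  rw [form_M_eq hk a w, ← re_dot_self w]
  exact re_form_QGQ_ge (P.L ^ k) (Mk P k) a ha _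

/-- **FILE 3's `TorusHyps` FOR THE PRINTED OPERATORS WITH NO ANALYTIC HYPOTHESIS LEFT**: the (1.18) clauses with `q₀ = q₁ = r_Q = 1` (file 3),
`G_k` symmetric (§2) and (1.100) with `γ₁ = γ₀/(4d + a)` (this §). [cite: BalabanImbrieJaffe1985, (7.2.2) p.325] -/
theorem torusHyps_deltaA (hk : k ≤ P.m + P.K) {a : ℝ} (ha : 0 < a) :
    TorusHyps P k (deltaAData hk a) (gam0 P.d / (4 * P.d + a)) 1 1 1 :=
  torusHyps_std hk (gammaE_pos a ha) (Gk_isSymm hk ha) (M_lower_deltaA hk ha)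

/-- **ROW C1.Eq7.2.1-7.2.2 ON THE TORUS FOR THE PRINTED OPERATOR `H_k = G_kQ_k^*(Q_kG_kQ_k^*)⁻¹`, `G_k = Δ_a⁻¹` of [6I] (1.69)–(1.71), (1.103)**:
`KernelData.Ineq722` for the family of scales `lev k ≤ m + K` GIVEN ONLY the three displayed members of [6I] Proposition 1.2 for these
kernels (`Prop12Hyps C Cα δ₀`, k-independent constants) — the symmetry of `G_k` and the lower bound (1.100) being THEOREMS (§2, §5), the
geometry and the averaging operators being file 3's theorems. [cite: BalabanImbrieJaffe1985, (7.2.2) p.325] -/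
theorem ineq722_deltaA (lev : ℕ → ℕ) (hlev : ∀ k, lev k ≤ P.m + P.K) {a : ℝ} (ha : 0 < a) (BondU : ℕ → Type)
    (distEB : (k : ℕ) → Balaban1983to89.Site P 0 → BondU k → ℝ)
    (Cker : (k : ℕ) → Fin P.d → Fin P.d → Balaban1983to89.Site P (lev k) → Balaban1983to89.Site P (lev k) → ℝ)
    (Dker : (k : ℕ) → Balaban1983to89.Site P 0 → BondU k → ℝ) {C δ₀ : ℝ} {Cα : ℝ → ℝ}
    (h12 : ∀ k, (torusRep P (lev k) (deltaAData (hlev k) a)).Prop12Hyps C Cα δ₀) :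
    KernelData.Ineq722 (fun k => torusKernelData P (lev k) (deltaAData (hlev k) a) (BondU k) (distEB k) (Cker k) (Dker k)) :=
  ineq722_torus lev hlev (fun k => deltaAData (hlev k) a) BondU distEB Cker Dker (fun k => torusHyps_deltaA (hlev k) ha) h12

/-- **The same with [6I] Proposition 1.2 BY ITS TREE NAME** (`B5.Prop12Printed` for the family of torus carriers): p. 325 «This inequality is
a consequence of Proposition 1.2 and the representation (1.103) of [6I]» for the PRINTED `G_k = Δ_a⁻¹`, with NO other hypothesis.
[cite: BalabanImbrieJaffe1985, (7.2.2) p.325] -/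
theorem ineq722_deltaA_of_prop12Printed (lev : ℕ → ℕ) (hlev : ∀ k, lev k ≤ P.m + P.K) {a : ℝ} (ha : 0 < a) (BondU : ℕ → Type)
    (distEB : (k : ℕ) → Balaban1983to89.Site P 0 → BondU k → ℝ)
    (Cker : (k : ℕ) → Fin P.d → Fin P.d → Balaban1983to89.Site P (lev k) → Balaban1983to89.Site P (lev k) → ℝ)
    (Dker : (k : ℕ) → Balaban1983to89.Site P 0 → BondU k → ℝ)
    (h12 : B5.Prop12Printed (fun k => settingOf (torusRep P (lev k) (deltaAData (hlev k) a)) k)) :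
    KernelData.Ineq722 (fun k => torusKernelData P (lev k) (deltaAData (hlev k) a) (BondU k) (distEB k) (Cker k) (Dker k)) :=
  ineq722_torus_of_prop12Printed lev hlev (fun k => deltaAData (hlev k) a) BondU distEB Cker Dker
    (fun k => torusHyps_deltaA (hlev k) ha) h12

/-- **SECT. 7.2, FIRST PARAGRAPH, ON THE TORUS FOR THE PRINTED OPERATORS** (the `sect72_torusStd` of `BIJ85Ineq724Torus` with its two analytic
hypotheses discharged): for `H_k = G_kQ_k^*(Q_kG_kQ_k^*)⁻¹`, `G_k = Δ_a⁻¹`, `D_k = λ(H_k(·; b))(x)` of (5.1.13) at `c = L^k`, BOTH typed displays hold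
with constants independent of `k` — (7.2.2) `KernelData.Ineq722` and (7.2.4) `KernelData.Ineq724 (d·const722·e^{3δ/2}) δ` — GIVEN ONLY the three
displayed members of [6I] Proposition 1.2. [cite: BalabanImbrieJaffe1985, (7.2.2) p.325] -/
theorem sect72_deltaA (lev : ℕ → ℕ) (hlev : ∀ k, lev k ≤ P.m + P.K) {a : ℝ} (ha : 0 < a)
    (Ck : (k : ℕ) → Fin P.d → Fin P.d → Balaban1983to89.Site P (lev k) → Balaban1983to89.Site P (lev k) → ℝ) {C δ₀ : ℝ} {Cα : ℝ → ℝ}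
    (h12 : ∀ k, (torusRep P (lev k) (deltaAData (hlev k) a)).Prop12Hyps C Cα δ₀) :
    KernelData.Ineq722 (fun k => torusKernelData P (lev k) (deltaAData (hlev k) a) (PBond P (lev k))
        (fun x b => distEU P (lev k) x b.src) (Ck k)
        (Dk ((P.L : ℝ) ^ lev k) (lev k) (fun μ ν x y => (torusRep P (lev k) (deltaAData (hlev k) a)).H (x, μ) (y, ν)))) ∧
    ∀ k, (torusKernelData P (lev k) (deltaAData (hlev k) a) (PBond P (lev k)) (fun x b => distEU P (lev k) x b.src) (Ck k)
        (Dk ((P.L : ℝ) ^ lev k) (lev k) (fun μ ν x y => (torusRep P (lev k) (deltaAData (hlev k) a)).H (x, μ) (y, ν)))).Ineq724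
      (P.d * (const722 P.d C δ₀ (gam0 P.d / (4 * P.d + a)) 1 1 1 (KYd P)
          * Real.exp (rate722 P.d C δ₀ (gam0 P.d / (4 * P.d + a)) 1 1 1 (KYd P) * (1 / 2))) *
        Real.exp (rate722 P.d C δ₀ (gam0 P.d / (4 * P.d + a)) 1 1 1 (KYd P) * (1 / 2 + 1 / 2)))
      (rate722 P.d C δ₀ (gam0 P.d / (4 * P.d + a)) 1 1 1 (KYd P)) :=
  ⟨ineq722_deltaA lev hlev ha (fun k => PBond P (lev k)) (fun k x b => distEU P (lev k) x b.src) Ck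
      (fun k => Dk ((P.L : ℝ) ^ lev k) (lev k) (fun μ ν x y => (torusRep P (lev k) (deltaAData (hlev k) a)).H (x, μ) (y, ν))) h12,
    fun k => ineq724_torusKernelData (hlev k) (torusHyps_deltaA (hlev k) ha) (h12 k) (Ck k)⟩
end

end Literature.MathematicalPhysics.QuantumFieldTheory.BalabanImbrieJaffe1984to88.BIJ85Ineq722DeltaA
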